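import Mathlib
import Summits.Langlands.Langlands.Theses.QuadraticWindow
import Literature.NumberTheory.Automorphic.AutomorphicTwistBJ
import Literature.NumberTheory.Automorphic.StrongMultiplicityOneSphericalProofs
import Literature.NumberTheory.GaloisRepresentations.IntegralGaloisActionProofs

/-!
# Crux `HostInducedRep` (stmt-Langlands-10902), line `grs-explicit-descent`, stub S1
# `stub_inducedPackage` — auxiliary lemmas (all proved, no definition, no named fact)

Support file for `QuadraticWindowHostInducedRepInducedPackage.lean` (the induced package
`Π = AI_{F/F₀}(π ⊗ ψ')` of the checked skeleton
`Cruxes/HostInducedRep/Lines/grs-explicit-descent.lean`).  Generic lemmas, reusable by the other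
stubs of the line (the signed twist S2 twists again; the patching stub S5 reads Frobenius clauses):

* Frobenius clauses of framed representations (`FramedGaloisRep.HasFrobCharpolyAt`):
  uniqueness at a place of a number field (`frobCharpoly_unique_aux`), the rank-one value is
  unique (`artinAvatar_frobValue_unique`), and in rank one a Frobenius clause forces
  unramifiedness (`artinAvatar_isUnramifiedAt_of_hasFrobCharpolyAt`; copies of §2 of the standing
  disprover's `Cruxes/HostInducedRep/Disproof.lean`, checked here).
* Twists at EVERY unramified place: a finite-order Hecke character `χ` unramified at `v` has a
  level `𝔪` of `χ ∘ det` PRIME TO `v` (`heckeCharacter_exists_level_not_dvd_of_isUnramifiedAt`: the tree's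
  `exists_principalCongruenceLevel_not_dvd_mul_ofLocal_inv_mem` peels the local factor
  `ι_v(GL_n(𝒪_v))` off a level inside `ker (χ ∘ det)`, and `χ (det ι_v(k_v)) = χ_v(det k_v) = 1`
  because `det k_v ∈ 𝒪_v^×`, `valued_det_eq_one_aux`), hence the Satake parameter of the
  Borel–Jacquet twist `π ⊗ (χ ∘ det)` (`AutomorphicRepData.twist`) at every place `v` where `π`
  has a parameter `α` and `χ` is unramified is `χ(ϖ_v) · α`
  (`hasSatakeParamAt_twist_at_unramified_place`; the tree had this outside an unspecified level,
  `AutomorphicRepData.HasSatakeParamAt.twist_of_isUnramifiedAt`, and almost everywhere,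
  `eventually_hasSatakeParamAt_twist`).  Arthur–Clozel 1989, Ch. 3, proof of Thm. 3.1 (p. 172):
  `t_{π ⊗ η, v} = η(ϖ_v) t_{π, v}`; Borel–Jacquet 1979, §4.6.
* Places in the quadratic window: `w ∣ v` in the crux's form `w.under (𝓞 F₀) = v` versus the
  tree's `w.asIdeal.under (𝓞 F₀) = v.asIdeal` (`place_under_eq_iff_asIdeal`); the crux's guard `e(w∣v) = 1 ∀ w ∣ v`
  versus Mathlib's `Algebra.IsUnramifiedIn` (`isUnramifiedIn_of_forall_ramificationIdx_eq_one`,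
  `ramificationIdx_eq_one_of_isUnramifiedIn_of_under_eq`); cofinitely many places avoid `ℓ`
  (`eventually_natCast_not_mem_asIdeal`); and RIDER 1 of the stub, `ℓ ∤ disc F ⇒ ℓ ∤ disc F₀`
  (`not_dvd_discr_base_of_not_dvd_discr`, from Mathlib `NumberField.discr_dvd_discr`).

References: [ArthurClozelAMS120] Ch. 3, proof of Thm. 3.1; [BorelJacquetCorvallis1979] §4.6;
Serre, *Abelian ℓ-adic representations* (1968), Ch. I §2.1.
-/

open scoped BigOperators Polynomial Classical
open Filter Set Function Polynomial IsDedekindDomain NumberField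
open Literature.NumberTheory.Automorphic Literature.NumberTheory.GaloisRepresentations

-- `Summit.Langlands.Langlands.…` (summit = sub-problem name, D-0017 layout) trips `dupNamespace`.
set_option linter.dupNamespace false
set_option autoImplicit false

noncomputable section

namespace Summit.Langlands.Langlands.Theorems.HostInducedRep.GrsExplicitDescent

section Frobenius

open scoped MatrixGroups

variable {K : Type} [Field K] [NumberField K] {A : Type*} [CommRing A] [TopologicalSpace A] {m : ℕ}

/-- Frobenius characteristic polynomials of a framed representation at a place of a number field
are unique (a prime above `v` exists and carries an arithmetic Frobenius). -/
private theorem frobCharpoly_unique_aux {v : HeightOneSpectrum (𝓞 K)} {ρ : FramedGaloisRep K A m}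
    {P Q : A[X]} (hP : ρ.HasFrobCharpolyAt v P) (hQ : ρ.HasFrobCharpolyAt v Q) : P = Q := by
  obtain ⟨𝔓, h𝔓⟩ := v.primesAbove_nonempty
  obtain ⟨σ, hσ⟩ := HeightOneSpectrum.exists_isArithFrobAt_of_mem_primesAbove_holds h𝔓
  rw [← hP 𝔓 h𝔓 σ hσ, ← hQ 𝔓 h𝔓 σ hσ]

/-- In rank one, two Frobenius clauses `X - C a`, `X - C b` at the same place force `a = b`. -/
theorem artinAvatar_frobValue_unique {v : HeightOneSpectrum (𝓞 K)} {ρ : FramedGaloisRep K A 1}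
    {a b : A} (ha : ρ.HasFrobCharpolyAt v (X - C a)) (hb : ρ.HasFrobCharpolyAt v (X - C b)) :
    a = b := by
  have h := frobCharpoly_unique_aux ha hb
  rwa [sub_right_inj, C_inj] at h

omit [NumberField K] in
/-- In rank one the characteristic polynomial is `X - C (the entry)`. -/
private theorem charpoly_rankOne_aux (ρ : FramedGaloisRep K A 1) (σ : Field.absoluteGaloisGroup K) :
    FramedRep.charpoly ρ σ = X - C (((ρ σ : GL (Fin 1) A) : Matrix (Fin 1) (Fin 1) A) 0 0) := by
  rw [FramedRep.charpoly, Matrix.charpoly, Matrix.det_fin_one, Matrix.charmatrix_apply_eq]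

omit [NumberField K] in
/-- A rank-one framed representation is determined at `σ` by its characteristic polynomial. -/
private theorem eq_of_charpoly_eq_rankOne_aux (ρ : FramedGaloisRep K A 1) {σ σ' : Field.absoluteGaloisGroup K}
    (h : FramedRep.charpoly ρ σ = FramedRep.charpoly ρ σ') : ρ σ = ρ σ' := by
  rw [charpoly_rankOne_aux, charpoly_rankOne_aux, sub_right_inj, C_inj] at h
  refine Units.ext (Matrix.ext fun i j ↦ ?_)
  rw [Subsingleton.elim i 0, Subsingleton.elim j 0]
  exact h

/-- **In rank one a Frobenius clause forces unramifiedness** (copy of §2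
`isUnramifiedAt_of_hasFrobCharpolyAt_rankOne` of the standing disprover's `Disproof.lean`): for
`τ ∈ I_𝔓` and a Frobenius `σ` at `𝔓`, `τσ` is again a Frobenius, so `ρ(τσ) = ρ(σ)` in `GL₁`. -/
theorem artinAvatar_isUnramifiedAt_of_hasFrobCharpolyAt {w : HeightOneSpectrum (𝓞 K)}
    (ρ : FramedGaloisRep K A 1) {P : A[X]} (hP : ρ.HasFrobCharpolyAt w P) : ρ.IsUnramifiedAt w := by
  intro 𝔓 h𝔓 τ hτ
  obtain ⟨σ, hσ⟩ := HeightOneSpectrum.exists_isArithFrobAt_of_mem_primesAbove_holds h𝔓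
  have hτσ : IsArithFrobAt (𝓞 K) (τ * σ) 𝔓 := (isArithFrobAt_mul_iff_of_mem_inertia hτ).mpr hσ
  have h1 : ρ (τ * σ) = ρ σ :=
    eq_of_charpoly_eq_rankOne_aux ρ ((hP 𝔓 h𝔓 _ hτσ).trans (hP 𝔓 h𝔓 σ hσ).symm)
  rwa [map_mul, mul_eq_right] at h1

end Frobenius

section Twist

open scoped MatrixGroups Topology

variable {n : ℕ} {K : Type} [Field K] [NumberField K]

/-- The determinant of a matrix over `K_v` with integral entries is integral. -/
private theorem valued_det_le_one_aux (v : HeightOneSpectrum (𝓞 K))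
    {M : Matrix (Fin n) (Fin n) (v.adicCompletion K)} (h : ∀ i j, Valued.v (M i j) ≤ 1) :
    Valued.v M.det ≤ 1 := by
  let M₀ : Matrix (Fin n) (Fin n) (v.adicCompletionIntegers K) :=
    Matrix.of fun i j ↦ ⟨M i j, (HeightOneSpectrum.mem_adicCompletionIntegers (R := 𝓞 K) K v).mpr (h i j)⟩
  have hM : M = (v.adicCompletionIntegers K).subtype.mapMatrix M₀ := by
    ext i j; rfl
  rw [hM, ← RingHom.map_det]
  exact (HeightOneSpectrum.mem_adicCompletionIntegers (R := 𝓞 K) K v).mp (M₀.det).2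

/-- The determinant of an element of `GL_n(𝒪_v)` (valued congruence subgroup of radius `1`) is a
local unit: `|det g|_v = 1`. -/
private theorem valued_det_eq_one_aux (v : HeightOneSpectrum (𝓞 K))
    {g : GL (Fin n) (v.adicCompletion K)}
    (hg : g ∈ valuedCongruenceSubgroup (Fin n) (1 : WithZero (Multiplicative ℤ))) :
    Valued.v ((Matrix.GeneralLinearGroup.det g : (v.adicCompletion K)ˣ) : v.adicCompletion K) = 1 := by
  obtain ⟨h₁, h₂, -⟩ := hg
  have hd : Valued.v ((g : Matrix (Fin n) (Fin n) (v.adicCompletion K)).det) ≤ 1 :=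
    valued_det_le_one_aux v h₁
  have hd' : Valued.v (((g⁻¹ : GL (Fin n) (v.adicCompletion K)) :
      Matrix (Fin n) (Fin n) (v.adicCompletion K)).det) ≤ 1 := valued_det_le_one_aux v h₂
  have hprod : (g : Matrix (Fin n) (Fin n) (v.adicCompletion K)).det *
      ((g⁻¹ : GL (Fin n) (v.adicCompletion K)) : Matrix (Fin n) (Fin n) (v.adicCompletion K)).det = 1 := by
    rw [← Matrix.det_mul, ← Units.val_mul, mul_inv_cancel, Units.val_one, Matrix.det_one]
  refine le_antisymm hd ?_
  calc (1 : WithZero (Multiplicative ℤ))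
      = Valued.v ((g : Matrix (Fin n) (Fin n) (v.adicCompletion K)).det) *
          Valued.v (((g⁻¹ : GL (Fin n) (v.adicCompletion K)) :
            Matrix (Fin n) (Fin n) (v.adicCompletion K)).det) := by rw [← map_mul, hprod, map_one]
    _ ≤ Valued.v ((g : Matrix (Fin n) (Fin n) (v.adicCompletion K)).det) * 1 :=
          mul_le_mul' le_rfl hd'
    _ = _ := by rw [mul_one]; rfl

/-- **A finite-order Hecke character has a level prime to any place at which it is unramified**:
if `χ` has finite order and is unramified at `v`, there is `𝔪 ≠ 0` with `v ∤ 𝔪` and `χ ∘ det`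
trivial on the principal congruence subgroup `K(𝔪) ≤ GL_n(𝔸_K)` (`K(𝔪) ⊆ ker(χ∘det) · ι_v(GL_n(𝒪_v))`
by `exists_principalCongruenceLevel_not_dvd_mul_ofLocal_inv_mem`, and `χ(det ι_v(k_v)) = χ_v(det k_v) = 1`
for `k_v ∈ GL_n(𝒪_v)` by unramifiedness; Borel–Jacquet 1979, §4.6). -/
theorem heckeCharacter_exists_level_not_dvd_of_isUnramifiedAt (n : ℕ) {χ : HeckeCharacter K}
    (hχ : χ.IsFiniteOrder) {v : HeightOneSpectrum (𝓞 K)} (hv : χ.IsUnramifiedAt v) :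
    ∃ 𝔪 : Ideal (𝓞 K), 𝔪 ≠ 0 ∧ ¬ v.asIdeal ∣ 𝔪 ∧
      ∀ k ∈ principalCongruenceLevel n K 𝔪, χ (Matrix.GeneralLinearGroup.det k) = 1 := by
  have hker := HeckeCharacter.ker_mem_nhds_of_isFiniteOrder hχ
  have hU : (Matrix.GeneralLinearGroup.det : GL (Fin n) (AdeleRing (𝓞 K) K) →* _) ⁻¹'
      {x : ideleGroup K | χ x = 1} ∈ 𝓝 (1 : GL (Fin n) (AdeleRing (𝓞 K) K)) :=
    Matrix.GeneralLinearGroup.continuous_det.continuousAt.preimage_mem_nhds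
      (by rw [map_one]; exact hker)
  obtain ⟨𝔪, h𝔪, hv𝔪, hk⟩ := exists_principalCongruenceLevel_not_dvd_mul_ofLocal_inv_mem n K v hU
  refine ⟨𝔪, h𝔪, hv𝔪, fun k hkm ↦ ?_⟩
  have h1 : χ (Matrix.GeneralLinearGroup.det
      (k * (GLn.ofLocal n K v ((AdelicGroupData.gl n K).toLocal v k))⁻¹)) = 1 := hk k hkm
  have hkv : (AdelicGroupData.gl n K).toLocal v k ∈
      valuedCongruenceSubgroup (Fin n) (1 : WithZero (Multiplicative ℤ)) :=
    toLocal_mem_valuedCongruenceSubgroup_one (principalCongruenceLevel_le n K 𝔪 hkm) v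
  set d : (v.adicCompletion K)ˣ := Matrix.GeneralLinearGroup.det ((AdelicGroupData.gl n K).toLocal v k)
  have hdv : Valued.v (d : v.adicCompletion K) = 1 := valued_det_eq_one_aux v hkv
  -- `d` comes from a unit of `𝒪_v`
  let d₀ : (v.adicCompletionIntegers K)ˣ :=
    ⟨⟨d, (HeightOneSpectrum.mem_adicCompletionIntegers (R := 𝓞 K) K v).mpr hdv.le⟩,
      ⟨((d⁻¹ : (v.adicCompletion K)ˣ) : v.adicCompletion K),
        (HeightOneSpectrum.mem_adicCompletionIntegers (R := 𝓞 K) K v).mpr (by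
          rw [Units.val_inv_eq_inv_val, map_inv₀, hdv, inv_one])⟩,
      Subtype.ext d.mul_inv, Subtype.ext d.inv_mul⟩
  have hd₀ : Units.map ((v.adicCompletionIntegers K).subtype : _ →* _) d₀ = d := Units.ext rfl
  have h2 : χ (localUnits v d) = 1 := by
    have := hv d₀
    rwa [hd₀, HeckeCharacter.localComponent_apply] at this
  rw [map_mul, map_inv, map_mul, map_inv, GLn.det_ofLocal, h2, inv_one, mul_one] at h1
  exact h1

/-- **Satake parameters of the twist `π ⊗ (χ ∘ det)` at EVERY place where `π` and `χ` are
unramified**: `t_{π ⊗ χ, v} = χ(ϖ_v) · t_{π, v}` (Arthur–Clozel 1989, Ch. 3, proof of Thm. 3.1,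
p. 172), from the tree's `HasSatakeParamAt.twist_of_isUnramifiedAt` at a level of `χ ∘ det` prime
to `v` (`heckeCharacter_exists_level_not_dvd_of_isUnramifiedAt`). -/
theorem hasSatakeParamAt_twist_at_unramified_place {hcpt : isCompact_glFiniteIntegralLevel n K}
    {π : AutomorphicRepData (AutomorphyDatum.gl n K hcpt)} {v : HeightOneSpectrum (𝓞 K)}
    {α : Multiset ℂ} (h : π.HasSatakeParamAt v α) {χ : HeckeCharacter K} (hχ : χ.IsFiniteOrder)
    (hv : χ.IsUnramifiedAt v) :
    (π.twist χ hχ).HasSatakeParamAt v (α.map (χ.valueAtUniformizer v * ·)) := by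
  obtain ⟨𝔪, h𝔪, hv𝔪, hχ𝔪⟩ := heckeCharacter_exists_level_not_dvd_of_isUnramifiedAt n hχ hv
  exact h.twist_of_isUnramifiedAt hχ h𝔪 hχ𝔪 hv𝔪 hv

/-- **Registered sub-goal of stub S1 (piece (ii): the twist at EVERY unramified place)**, explicit
form of `hasSatakeParamAt_twist_at_unramified_place`: for a finite-order Hecke character `χ` of `K`
and an automorphic `π` on `GL_n/K`, at every place `v` where `π` has Satake parameter `α` and `χ` is
unramified, the Borel–Jacquet twist `π ⊗ (χ ∘ det)` has Satake parameter `χ(ϖ_v) · α`. -/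
theorem stub_inducedPackage_twistUnramified :
    ∀ (n : ℕ) (K : Type) [Field K] [NumberField K] (hcpt : isCompact_glFiniteIntegralLevel n K)
      (π : AutomorphicRepData (AutomorphyDatum.gl n K hcpt)) (χ : HeckeCharacter K)
      (hχ : χ.IsFiniteOrder) (v : HeightOneSpectrum (𝓞 K)) (α : Multiset ℂ),
      π.HasSatakeParamAt v α → χ.IsUnramifiedAt v →
        (π.twist χ hχ).HasSatakeParamAt v (α.map (χ.valueAtUniformizer v * ·)) :=
  fun _ _ _ _ _ _ _ hχ _ _ h hv ↦ hasSatakeParamAt_twist_at_unramified_place h hχ hv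

end Twist

section Places

variable {F₀ F : Type} [Field F₀] [NumberField F₀] [Field F] [NumberField F] [Algebra F₀ F]

omit [NumberField F₀] [NumberField F] in
/-- `w ∣ v` in the two forms used by the crux (`w.under = v`) and by the tree (`asIdeal.under`). -/
theorem place_under_eq_iff_asIdeal (w : HeightOneSpectrum (𝓞 F)) (v : HeightOneSpectrum (𝓞 F₀)) :
    w.under (𝓞 F₀) = v ↔ w.asIdeal.under (𝓞 F₀) = v.asIdeal := by
  rw [HeightOneSpectrum.ext_iff, HeightOneSpectrum.under_asIdeal]

/-- A place of `F₀` all of whose extensions to `F` have `e = 1` is unramified in `F`. -/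
theorem isUnramifiedIn_of_forall_ramificationIdx_eq_one (v : HeightOneSpectrum (𝓞 F₀))
    (h : ∀ w : HeightOneSpectrum (𝓞 F), w.under (𝓞 F₀) = v → w.asIdeal.ramificationIdx (𝓞 F₀) = 1) :
    Algebra.IsUnramifiedIn (𝓞 F) v.asIdeal := by
  rw [Algebra.isUnramifiedIn_iff_forall_ramificationIdx_eq_one]
  intro 𝔓 _ h𝔓
  have hne : 𝔓 ≠ ⊥ := Ideal.ne_bot_of_liesOver_of_ne_bot v.ne_bot 𝔓
  exact h ⟨𝔓, inferInstance, hne⟩ ((place_under_eq_iff_asIdeal _ _).mpr h𝔓.over.symm)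

/-- Conversely, above a place unramified in `F` every place has `e = 1`. -/
theorem ramificationIdx_eq_one_of_isUnramifiedIn_of_under_eq {v : HeightOneSpectrum (𝓞 F₀)}
    (hv : Algebra.IsUnramifiedIn (𝓞 F) v.asIdeal) {w : HeightOneSpectrum (𝓞 F)}
    (hw : w.under (𝓞 F₀) = v) : w.asIdeal.ramificationIdx (𝓞 F₀) = 1 := by
  haveI := w.isPrime
  exact hv.ramificationIdx_eq_one ⟨((place_under_eq_iff_asIdeal w v).mp hw).symm⟩

/-- All but finitely many places of `F₀` avoid the rational prime `ℓ`. -/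
theorem eventually_natCast_not_mem_asIdeal (ℓ : ℕ) [Fact ℓ.Prime] :
    ∀ᶠ v : HeightOneSpectrum (𝓞 F₀) in cofinite, ((ℓ : ℕ) : 𝓞 F₀) ∉ v.asIdeal := by
  have hℓ : (Ideal.span {((ℓ : ℕ) : 𝓞 F₀)} : Ideal (𝓞 F₀)) ≠ 0 := by
    rw [Ne, Ideal.zero_eq_bot, Ideal.span_singleton_eq_bot]
    exact_mod_cast (Fact.out : ℓ.Prime).ne_zero
  rw [Filter.eventually_cofinite]
  refine (Ideal.finite_factors hℓ).subset fun v hv ↦ ?_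
  simp only [mem_setOf_eq, not_not] at hv
  exact (Ideal.dvd_span_singleton).mpr hv

/-- **Rider 1: `ℓ ∤ disc F ⇒ ℓ ∤ disc F₀`** (`disc F₀ ∣ disc F`, Mathlib `NumberField.discr_dvd_discr`). -/
theorem not_dvd_discr_base_of_not_dvd_discr {ℓ : ℕ} (h : ¬ ((ℓ : ℤ) ∣ NumberField.discr F)) :
    ¬ ((ℓ : ℤ) ∣ NumberField.discr F₀) :=
  fun h' ↦ h (h'.trans (NumberField.discr_dvd_discr F₀ F))

end Places

end Summit.Langlands.Langlands.Theorems.HostInducedRep.GrsExplicitDescent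

end
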